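import Summits.QuantumFields.GaugeBoot.DiagonalRPTorusHexDiagrams
import Summits.QuantumFields.GaugeBoot.DiagonalRPTorusHexCertOdd
import HarnessLib

/-!
# The strong-coupling diagrams of the bent-hexagon pair on ODD tori: kernel-checked scripts (gauge-boot, L3 `d = 3` uniform window, odd leg, brick 5)

HONEST FRAMING (cell `pub-gaugeboot`, page 1 of every file): the venture produces certified bounds
on lattice expectations at stated coupling, gauge group, dimension and torus size; NOT a mass gap,
NOT a continuum limit, NOT a string tension; NOT Yang–Mills-summit-bearing (barriers
`FixedCouplingUltralocality`, `PerturbativeInvisibility`). This module is a KERNEL-CHECKED FINITE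
CERTIFICATE for a structural NEGATIVE result (a coupling window UNIFORM in the torus size for the
failure of closed-half diagonal reflection positivity on `(ℤ/L)^3`, `L` odd); it discharges
nothing by itself.

## Content (local chart at the base `y` of the hexagon; data of `DiagonalRPTorusHexCertOdd`)

The eight faces of the closed surface "short annulus ∪ two hexagons": `gWord` (the hexagon
`γ_y`, as in the even leg), `fWordOdd = ((1,0,0), thexW)` (the mirror image `θγ_{y₀}`, `θy₀ = y + e₀`),
`wordsOf tubeTodd` (six plaquette words).

* ★★ **`runOps_annulusOdd`** — a 29-step gluing script (7 glues, 1 empty word;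
  `HOME/pub-gaugeboot-lean3/gen47/tools/j2_script_odd.py`) CHECKS:
  `runOps 4 annulusScriptOdd (fWordOdd :: gWord :: wordsOf tubeTodd) = some (7, 1)`, i.e.
  `E[Re χ(W_{θγ}) Re χ(W_{γ}) ∏_{q ∈ annulus} Re χ(U_q)] = c₁^7 · N` under (R1) — a sphere with
  eight faces.
* ★ **`hasLonely_f_odd`, `hasLonely_g_odd`, `hasLonely_fg_odd`** — every proper sub-diagram has a
  lonely link (`decide` over the `2^6` sublists).

Standard axioms only (`decide +kernel`).
-/

namespace Summit.QuantumFields.GaugeBoot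

namespace DiagRPHex

/-- The word of `f = Re χ(W_{θγ})` on an odd torus, based at `(1,0,0)` (`= θy₀ = y + e₀`). -/
def fWordOdd : LSite × Word 3 := ((1, 0, 0), thexW)

/-- The gluing script for the eight-face sphere (7 glues, 1 empty word). -/
def annulusScriptOdd : List GOp :=
  [.rev 6, .rev 2, .glue 3 0 3 0, .bt 0 2, .glue 1 0 3 0, .rot 0, .bt 0 6, .rev 3, .glue 1 0 5 0,
   .bt 0 4, .rot 0, .bt 0 4, .glue 0 1 0 0, .rev 2, .glue 1 0 7 0, .rot 0, .bt 0 8, .rot 0, .bt 0 6,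
   .glue 0 2 0 1, .rot 0, .bt 0 6, .rot 0, .bt 0 4, .glue 1 0 2 0, .bt 0 1, .bt 0 0, .bt 0 0, .nilw 0]

/-- ★★ **The short annulus diagram glues to `c₁^7 N`**: the script checks. -/
theorem runOps_annulusOdd :
    runOps 4 annulusScriptOdd (fWordOdd :: gWord :: wordsOf tubeTodd) = some (7, 1) := by
  decide +kernel

/-- `thexW` from `(1,0,0)` reads the links of `LE₁odd` (as a set). -/
theorem ledges_thexW_odd_perm : (ledges (1, 0, 0) thexW).Perm LE₁odd := by decide +kernel

/-- The odd `f`-word is closed. -/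
theorem lendpoint_thexW_odd : lendpoint (1, 0, 0) thexW = (1, 0, 0) := by decide +kernel

/-- ★ Every sub-diagram `{θγ} ∪ S` of the odd annulus has a lonely link. -/
theorem hasLonely_f_odd : ∀ S ∈ tubeTodd.sublists, hasLonely 4 (fWordOdd :: wordsOf S) = true := by
  decide +kernel

/-- ★ Every sub-diagram `{γ} ∪ S` of the odd annulus has a lonely link. -/
theorem hasLonely_g_odd : ∀ S ∈ tubeTodd.sublists, hasLonely 4 (gWord :: wordsOf S) = true := by
  decide +kernel

/-- ★ Every PROPER sub-diagram `{θγ, γ} ∪ S` of the odd annulus has a lonely link. -/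
theorem hasLonely_fg_odd : ∀ S ∈ tubeTodd.sublists, S ≠ tubeTodd →
    hasLonely 4 (fWordOdd :: gWord :: wordsOf S) = true := by
  decide +kernel

end DiagRPHex

end Summit.QuantumFields.GaugeBoot
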